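import Summits.BirchSwinnertonDyer.Rank1Residual.X1.GeneratorBoundMu
import Summits.BirchSwinnertonDyer.Rank1Residual.X1.GeneratorCountLambda
import Summits.BirchSwinnertonDyer.Rank1Residual.X1.GeneratorCountLayer
import HarnessLib

/-!
# GREENBERG'S INEQUALITY AT LAYER `n`: `#(X/(p, ω_n)X) ≤ p^{λ(X) + pⁿ·μ(X)}` — route T's bound
# `B_n ≤ λ + pⁿ μ` in the kernel (cell `b2b-bsdres`, unit `b2b-bsdres-eisenstein-p1`, gen 17;
# X1R0-GAPMAP §14.1, §25.7 V76 (iii), §26)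

HONEST FRAMING (run/shared/lean/b2b/bsd-rank1-residual/, verbatim in every file): the goal of the
cell is to DELETE the COMBINATION-SHAPED residual classes of the Birch–Swinnerton-Dyer formula for
ALL analytic-rank `≤ 1` elliptic curves over `ℚ` — "full BSD formula for every rank `≤ 1` curve in
class `C`" assembled STRICTLY from published theorems — so that the rank-`≤ 1` remainder becomes
exactly the CONSTRUCTION-SHAPED classes, which are TYPED (missing-input `Prop`s), NOT attempted.
This is not "finishing BSD". Sub-cell `b2b-bsdres-eisenstein-p1` (CLASS-OWNERS row "X1 (r = 0)"):
research route; NO CLAIM BEYOND STATED CLASSES; nothing here changes a label; nothing is booked.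
THEOREMS ONLY — no definition, no named fact, no typed input introduced, nothing about any
particular curve asserted.

## What and why

Route T's census (X1R0-GAPMAP §14.1) certifies `λ ≥ B_n − pⁿ μ` at every LAYER `n`, where `B_n`
counts `p`-torsion classes of `Sel_{p^∞}(E/ℚ_∞)` fixed by `Γ_n = Γ^{pⁿ}` — i.e. it uses
`dim_{𝔽_p} X/(p, ω_n)X ≤ λ(X) + pⁿ μ(X)`, `ω_n = (1+T)^{pⁿ} − 1`. Gen 17 FILE 2
(`X1/GeneratorBoundMu.lean`) proved the layer-`0` case `#(X/𝔪X) ≤ p^{λ+μ}`; FILE 4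
(`X1/GeneratorCountLayer.lean`) proved the layer-`n` pairing `#t ≤ #(X/I_n X)`, `I_n = (p, ω_n)`.
THIS FILE proves the layer-`n` bound, for every finitely generated torsion `Λ`-module `X` without
nonzero finite submodules, by the same dévissage `0 → X_t = X[p^∞] → X → X_f → 0`:

* §1 `natCard_quotient_span_pow_smul_top_le`: **`#(N/r^k N) ≤ #(N/rN)^k`** for any module `N` over a
  commutative ring and any `r` (filtration `r^i N / r^{i+1} N ↞ N/rN`).
* §2 `#(X_t/I_n X_t) ≤ #(X_t/T^{pⁿ} X_t) ≤ #(X_t/T X_t)^{pⁿ} = p^{pⁿ μ(X)}` (`T^{pⁿ} ∈ I_n`,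
  FILE 4 `maximalIdeal_pow_le_layerIdeal`; `#(X_t/TX_t) = p^{μ(X_t)} = p^{μ(X)}`, LEMMA M₀'s Euler
  characteristic `GeneratorBound.natCard_coinvariants_eq` as in FILE 2 §3).
* §3 `#(X_f/I_n X_f) ≤ p^{λ(X)}` (`p ∈ I_n`, FILE 1 `natCard_quotient_smul_top_le_pow_lambdaInvariant`,
  FILE 2 `λ(X_f) = λ(X)`), and right exactness (FILE 2 `natCard_quotient_smul_top_le_mul`):
  **`natCard_quotient_layerIdeal_le_pow`: `#(X/I_n X) ≤ p^{λ(X) + pⁿ μ(X)}`.**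
* §4 with FILE 4: **`card_layerClasses_le_pow`** — over a number field `K` with `E(K)[p] = 0`, every
  finite family of `p`-torsion classes of `A_n = h_n⁻¹(Sel_{p^∞}(E/K_∞)) ⊆ H¹(K_n, E[p^∞])` has at
  most `p^{λ + pⁿ μ}` members, for every dual datum whose `X` is torsion without nonzero finite
  submodules — route T's `B_n ≤ λ + pⁿ μ` with the layer-`n` classes as the only remaining input.

What is still NOT in the kernel (X1R0-GAPMAP §26): the production of `p^{t_n + a − 2δ}` such classes
from Tamagawa data over `ℚ_n` (n1011's layer budget files produce `p^{t_n}` classes of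
`Sel_{p^∞}(E/ℚ_∞)[p]` but transport them without their `Γ_n`-invariance), and LEMMA M at layer `n`
(the `ord`-weight). Nothing is booked by this file.

References: [GreenbergLNM1716] §1 p. 60, §3 pp. 85–86, §4 Lemma 4.2, Prop. 4.14/4.15, p. 137;
[Washington1997] §13.2 (Lemma 13.15 ff.: `ω_n`, `ν_{n,e}`); X1R0-GAPMAP §14.1, §21–§26.
-/

noncomputable section

open scoped Classical

open PowerSeries WeierstrassCurve Literature.NumberTheory.EllipticCurves
  Literature.NumberTheory.EllipticCurves.IwasawaAlgebra IsLocalRing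
  Summit.BirchSwinnertonDyer.Rank1Residual.X1.MuLambda
  Summit.BirchSwinnertonDyer.Rank1Residual.X1.MuPart
  Summit.BirchSwinnertonDyer.Rank1Residual.X1.ParitySqueeze
  Summit.BirchSwinnertonDyer.Rank1Residual.X1.GeneratorBoundMu
  Summit.BirchSwinnertonDyer.Rank1Residual.X1.GeneratorCountLayer

set_option autoImplicit false

universe u

namespace Summit.BirchSwinnertonDyer.Rank1Residual.X1.GeneratorBoundMuLayer

/-! ## §1. `#(N/r^k N) ≤ #(N/rN)^k` -/

section Filtration

variable {R : Type*} [CommRing R] (N : Type*) [AddCommGroup N] [Module R N] (r : R)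

/-- **`#(N/r^kN) ≤ #(N/rN)^k`** (and `N/r^kN` is finite) for a module `N` over a commutative ring
with `N/rN` finite: the kernel `r^kN/r^{k+1}N` of `N/r^{k+1}N ↠ N/r^kN` is the image of `N/rN` under
multiplication by `r^k`. [folklore] -/
theorem finite_and_natCard_quotient_span_pow_smul_top_le (k : ℕ)
    [Finite (N ⧸ Ideal.span {r} • (⊤ : Submodule R N))] :
    Finite (N ⧸ Ideal.span {r ^ k} • (⊤ : Submodule R N)) ∧
      Nat.card (N ⧸ Ideal.span {r ^ k} • (⊤ : Submodule R N)) ≤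
        Nat.card (N ⧸ Ideal.span {r} • (⊤ : Submodule R N)) ^ k := by
  induction k with
  | zero =>
    rw [pow_zero, pow_zero, Ideal.span_singleton_one, Submodule.top_smul]
    exact ⟨Finite.of_subsingleton, le_of_eq Nat.card_unique⟩
  | succ k ih =>
    obtain ⟨hfinA, hcardA⟩ := ih
    set A := Ideal.span {r ^ k} • (⊤ : Submodule R N) with hA
    set B := Ideal.span {r ^ (k + 1)} • (⊤ : Submodule R N) with hB
    have hBA : B ≤ A := Submodule.smul_mono_left
      (Ideal.span_singleton_le_span_singleton.mpr (pow_dvd_pow r (Nat.le_succ k)))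
    -- `N/rN ↠ A/B`, `y ↦ r^k y`
    let f₁ : N →ₗ[R] N ⧸ B := B.mkQ ∘ₗ (r ^ k • LinearMap.id)
    have hf₁ : ∀ y : N, f₁ y ∈ A.map B.mkQ := fun y ↦
      Submodule.mem_map_of_mem (Submodule.smul_mem_smul (Ideal.mem_span_singleton_self _)
        Submodule.mem_top)
    have hker : Ideal.span {r} • (⊤ : Submodule R N) ≤ LinearMap.ker (f₁.codRestrict _ hf₁) := by
      rw [Submodule.ideal_span_singleton_smul]
      rintro x hx
      obtain ⟨y, -, rfl⟩ := (Submodule.mem_smul_pointwise_iff_exists x r ⊤).mp hx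
      rw [LinearMap.mem_ker]
      refine Subtype.ext ?_
      change B.mkQ (r ^ k • (r • y)) = 0
      rw [Submodule.mkQ_apply, Submodule.Quotient.mk_eq_zero, ← mul_smul, ← pow_succ]
      exact Submodule.smul_mem_smul (Ideal.mem_span_singleton_self _) Submodule.mem_top
    let g := (Ideal.span {r} • (⊤ : Submodule R N)).liftQ (f₁.codRestrict _ hf₁) hker
    have hg : Function.Surjective g := by
      rintro ⟨z, hz⟩
      obtain ⟨a, ha, rfl⟩ := Submodule.mem_map.mp hz
      rw [hA, Submodule.ideal_span_singleton_smul] at ha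
      obtain ⟨y, -, rfl⟩ := (Submodule.mem_smul_pointwise_iff_exists a (r ^ k) ⊤).mp ha
      exact ⟨Submodule.Quotient.mk y, Subtype.ext rfl⟩
    haveI hfinAB : Finite (A.map B.mkQ) := Finite.of_surjective g hg
    haveI : Finite (N ⧸ A) := hfinA
    -- `#(N/B) = #(A/B) · #(N/A)`
    have hcard : Nat.card (N ⧸ B) = Nat.card (A.map B.mkQ) * Nat.card (N ⧸ A) := by
      rw [Submodule.card_eq_card_quotient_mul_card (A.map B.mkQ),
        Nat.card_congr (Submodule.quotientQuotientEquivQuotient B A hBA).toEquiv]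
    refine ⟨?_, ?_⟩
    · refine Nat.finite_of_card_ne_zero ?_
      rw [hcard]
      exact mul_ne_zero (Nat.card_pos (α := A.map B.mkQ)).ne' (Nat.card_pos (α := N ⧸ A)).ne'
    · rw [hcard, pow_succ, mul_comm (Nat.card (N ⧸ Ideal.span {r} • (⊤ : Submodule R N)) ^ k)]
      exact Nat.mul_le_mul (Nat.card_le_card_of_surjective g hg) hcardA

end Filtration

/-! ## §2. The `p`-power torsion part at layer `n`: `#(X_t/I_n X_t) ≤ p^{pⁿ μ(X)}` -/

section Layer

variable {p : ℕ} [hp : Fact p.Prime] (M : Type u) [AddCommGroup M] [Module (IwasawaAlgebra p) M]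

/-- **`#(X_t/TX_t) = p^{μ(X)}`** (and `X_t/TX_t` is finite) for `X` finitely generated torsion
without nonzero finite submodules, `X_t = X[p^∞]`: LEMMA M₀'s Euler characteristic
(`GeneratorBound.natCard_coinvariants_eq`) at a generator `f_t` of `char X_t`, `λ(f_t) = 0`,
`v_p(f_t(0)) = μ(f_t) = μ(X_t) = μ(X)` (FILE 2 §2–§3). [cite: GreenbergLNM1716, §4 Lemma 4.2]
[cite: Washington1997, §13.2] -/
theorem natCard_coinvariants_torsionP_eq [Module.Finite (IwasawaAlgebra p) M]
    (hM : Module.IsTorsion (IwasawaAlgebra p) M)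
    (hnf : ∀ N : Submodule (IwasawaAlgebra p) M, Finite N → N = ⊥) :
    Finite (Submodule.torsion' (IwasawaAlgebra p) M
        (Submonoid.powers (C (p : ℤ_[p]) : IwasawaAlgebra p)) ⧸
      Ideal.span {(X : IwasawaAlgebra p)} • (⊤ : Submodule (IwasawaAlgebra p)
        (Submodule.torsion' (IwasawaAlgebra p) M
          (Submonoid.powers (C (p : ℤ_[p]) : IwasawaAlgebra p))))) ∧
    Nat.card (Submodule.torsion' (IwasawaAlgebra p) M
        (Submonoid.powers (C (p : ℤ_[p]) : IwasawaAlgebra p)) ⧸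
      Ideal.span {(X : IwasawaAlgebra p)} • (⊤ : Submodule (IwasawaAlgebra p)
        (Submodule.torsion' (IwasawaAlgebra p) M
          (Submonoid.powers (C (p : ℤ_[p]) : IwasawaAlgebra p))))) = p ^ muInvariant p M := by
  haveI : IsNoetherian (IwasawaAlgebra p) M := isNoetherian_of_isNoetherianRing_of_finite _ M
  set Xt := Submodule.torsion' (IwasawaAlgebra p) M
    (Submonoid.powers (C (p : ℤ_[p]) : IwasawaAlgebra p)) with hXt
  haveI : Module.Finite (IwasawaAlgebra p) Xt :=
    Module.Finite.of_injective Xt.subtype (Submodule.injective_subtype _)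
  have hTt : Module.IsTorsion (IwasawaAlgebra p) Xt :=
    Literature.NumberTheory.EllipticCurves.isTorsion_of_injective Xt.subtype
      (Submodule.injective_subtype _) hM
  obtain ⟨g, hg0, hchar⟩ := exists_charGenerator_ne_zero Xt hTt
  have hlam : lam g = 0 := by
    rw [lam_generator_eq_lambdaInvariant Xt hTt hg0 hchar, hXt, lambdaInvariant_torsionP_eq_zero M]
  obtain ⟨hne, hval⟩ := valuation_constantCoeff_of_lam_eq_zero hg0 hlam
  have h0 : constantCoeff g ≠ 0 := fun h ↦ hne (by rw [h, PadicInt.coe_zero])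
  have hval' : (constantCoeff g).valuation = muInvariant p M := by
    rw [PadicInt.valuation_coe, mu_generator_eq_muInvariant Xt hTt hg0 hchar, hXt,
      muInvariant_torsionP_eq M hM] at hval
    exact_mod_cast hval
  obtain ⟨hfin, hcard⟩ := GeneratorBound.natCard_coinvariants_eq Xt hTt
    (torsionP_finite_eq_bot M hnf) g hchar h0
  refine ⟨hfin, ?_⟩
  rw [hcard, ← GeneratorBound.valuation_constantCoeff_eq_eulerExp Xt hTt g hchar h0, hval']

/-- **`#(X_t/I_n X_t) ≤ p^{pⁿ μ(X)}`** (and `X_t/I_n X_t` is finite), `I_n = (p, (1+T)^{pⁿ} − 1)`: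
`T^{pⁿ} ∈ I_n` (FILE 4 `maximalIdeal_pow_le_layerIdeal`), so `X_t/I_n X_t` is a quotient of
`X_t/T^{pⁿ}X_t`, which has at most `#(X_t/TX_t)^{pⁿ} = p^{pⁿ μ(X)}` elements (§1).
[cite: GreenbergLNM1716, §4 Lemma 4.2] [cite: Washington1997, §13.2] -/
theorem natCard_torsionP_quotient_layerIdeal_le [Module.Finite (IwasawaAlgebra p) M]
    (hM : Module.IsTorsion (IwasawaAlgebra p) M)
    (hnf : ∀ N : Submodule (IwasawaAlgebra p) M, Finite N → N = ⊥) (n : ℕ) :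
    Finite (Submodule.torsion' (IwasawaAlgebra p) M
        (Submonoid.powers (C (p : ℤ_[p]) : IwasawaAlgebra p)) ⧸
      Ideal.span {(C (p : ℤ_[p]) : IwasawaAlgebra p), (1 + (X : IwasawaAlgebra p)) ^ p ^ n - 1} •
        (⊤ : Submodule (IwasawaAlgebra p) (Submodule.torsion' (IwasawaAlgebra p) M
          (Submonoid.powers (C (p : ℤ_[p]) : IwasawaAlgebra p))))) ∧
    Nat.card (Submodule.torsion' (IwasawaAlgebra p) M
        (Submonoid.powers (C (p : ℤ_[p]) : IwasawaAlgebra p)) ⧸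
      Ideal.span {(C (p : ℤ_[p]) : IwasawaAlgebra p), (1 + (X : IwasawaAlgebra p)) ^ p ^ n - 1} •
        (⊤ : Submodule (IwasawaAlgebra p) (Submodule.torsion' (IwasawaAlgebra p) M
          (Submonoid.powers (C (p : ℤ_[p]) : IwasawaAlgebra p))))) ≤
      p ^ (p ^ n * muInvariant p M) := by
  set Xt := Submodule.torsion' (IwasawaAlgebra p) M
    (Submonoid.powers (C (p : ℤ_[p]) : IwasawaAlgebra p)) with hXt
  set I := Ideal.span {(C (p : ℤ_[p]) : IwasawaAlgebra p),
    (1 + (X : IwasawaAlgebra p)) ^ p ^ n - 1} with hI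
  obtain ⟨hfin, hcard⟩ := natCard_coinvariants_torsionP_eq M hM hnf
  haveI := hfin
  obtain ⟨hfink, hboundk⟩ :=
    finite_and_natCard_quotient_span_pow_smul_top_le Xt (X : IwasawaAlgebra p) (p ^ n)
  haveI := hfink
  rw [hcard, ← pow_mul, mul_comm] at hboundk
  -- `T^{pⁿ} ∈ I`
  have hXI : (X : IwasawaAlgebra p) ^ p ^ n ∈ I :=
    maximalIdeal_pow_le_layerIdeal n (Ideal.pow_mem_pow
      ((IsLocalRing.mem_maximalIdeal _).mpr (not_isUnit_X p)) _)
  have hle : Ideal.span {(X : IwasawaAlgebra p) ^ p ^ n} • (⊤ : Submodule (IwasawaAlgebra p) Xt) ≤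
      I • (⊤ : Submodule (IwasawaAlgebra p) Xt) :=
    Submodule.smul_mono_left ((Ideal.span_singleton_le_iff_mem _).mpr hXI)
  have hsurj := Submodule.factor_surjective hle
  exact ⟨Finite.of_surjective _ hsurj, (Nat.card_le_card_of_surjective _ hsurj).trans hboundk⟩

/-! ## §3. GREENBERG'S INEQUALITY AT LAYER `n` -/

/-- **GREENBERG'S INEQUALITY AT LAYER `n`: `#(X/I_n X) ≤ p^{λ(X) + pⁿ μ(X)}`**,
`I_n = (p, (1+T)^{pⁿ} − 1)`, for a finitely generated torsion `Λ = ℤ_p⟦T⟧`-module `X` without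
nonzero finite `Λ`-submodules — i.e. `dim_{𝔽_p} X/(p, ω_n)X ≤ λ + pⁿ μ`; for `X = X(E/K_∞)` the
left side is dual to `Sel_E(K_∞)_p[p]^{Γ_n}` (route T's `B_n ≤ λ + pⁿ μ`, X1R0-GAPMAP §14.1).
Dévissage `0 → X[p^∞] → X → X_f → 0`: §2, FILE 1 `natCard_quotient_smul_top_le_pow_lambdaInvariant`
(`p ∈ I_n`, `λ(X_f) = λ(X)`), FILE 2 right exactness. [cite: GreenbergLNM1716, §1 p. 60, §4 Lemma 4.2, p. 137]
[cite: Washington1997, §13.2] -/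
theorem natCard_quotient_layerIdeal_le_pow [Module.Finite (IwasawaAlgebra p) M]
    (hM : Module.IsTorsion (IwasawaAlgebra p) M)
    (hnf : ∀ N : Submodule (IwasawaAlgebra p) M, Finite N → N = ⊥) (n : ℕ) :
    Nat.card (M ⧸ Ideal.span {(C (p : ℤ_[p]) : IwasawaAlgebra p),
        (1 + (X : IwasawaAlgebra p)) ^ p ^ n - 1} • (⊤ : Submodule (IwasawaAlgebra p) M)) ≤
      p ^ (lambdaInvariant p M + p ^ n * muInvariant p M) := by
  set Xt := Submodule.torsion' (IwasawaAlgebra p) M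
    (Submonoid.powers (C (p : ℤ_[p]) : IwasawaAlgebra p)) with hXt
  set I := Ideal.span {(C (p : ℤ_[p]) : IwasawaAlgebra p),
    (1 + (X : IwasawaAlgebra p)) ^ p ^ n - 1} with hI
  obtain ⟨hfin_t, hle_t⟩ := natCard_torsionP_quotient_layerIdeal_le M hM hnf n
  -- the `p`-torsion-free quotient
  have hTf : Module.IsTorsion (IwasawaAlgebra p) (M ⧸ Xt) :=
    Literature.NumberTheory.EllipticCurves.isTorsion_of_surjective Xt.mkQ
      (Submodule.mkQ_surjective _) hM
  have hpI : augIdealP p ≤ I :=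
    (Ideal.span_singleton_le_iff_mem _).mpr (Ideal.subset_span (by simp))
  have hle_f : Nat.card ((M ⧸ Xt) ⧸ I • (⊤ : Submodule (IwasawaAlgebra p) (M ⧸ Xt))) ≤
      p ^ lambdaInvariant p M := by
    rw [← lambdaInvariant_quotient_torsionP_eq M hM]
    exact GeneratorCountLambda.natCard_quotient_smul_top_le_pow_lambdaInvariant (M ⧸ Xt) hTf
      (muInvariant_quotient_torsionP_eq_zero M hM) (quotient_torsionP_finite_eq_bot M) hpI
  calc _ ≤ _ := natCard_quotient_smul_top_le_mul I Xt hfin_t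
    _ ≤ p ^ (p ^ n * muInvariant p M) * p ^ lambdaInvariant p M := Nat.mul_le_mul hle_t hle_f
    _ = p ^ (lambdaInvariant p M + p ^ n * muInvariant p M) := by rw [← pow_add, add_comm]

end Layer

/-! ## §4. Route T's inequality at layer `n`: `#A_n[p]`-families have at most `p^{λ + pⁿ μ}` members -/

section RouteT

variable {K : Type u} [Field K] [NumberField K] {W : WeierstrassCurve K} {p : ℕ} [hp : Fact p.Prime]
  {κ : ZpExtension K p} {γ : Field.absoluteGaloisGroup K} (D : W.SelmerDualData κ γ)

/-- **`#t ≤ p^{λ(X) + pⁿ μ(X)}` for every finite family `t` of DISTINCT `p`-torsion classes of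
`Sel_{p^∞}(E/K_∞)` fixed by `conj_{γ^{pⁿ}}`**, for every Pontryagin-dual datum `D` over `(κ, γ)`
whose `X = D.X` is finitely generated torsion without nonzero finite submodules (FILE 4's pairing +
§3). [cite: GreenbergLNM1716, §1 p. 60, p. 137] -/
theorem card_le_pow_of_fixed [Module.Finite (IwasawaAlgebra p) D.X] (hX : D.IsTorsion)
    (hnf : ∀ N : Submodule (IwasawaAlgebra p) D.X, Finite N → N = ⊥) (n : ℕ)
    (t : Finset (W.selmerInfty κ))
    (ht : ∀ s ∈ t, p • s = 0 ∧
      W.conjH1 p κ.kerSubgroup (γ ^ p ^ n) (s : W.subgroupH1 p κ.kerSubgroup) = s) :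
    t.card ≤ p ^ (lambdaInvariant p D.X + p ^ n * muInvariant p D.X) :=
  (card_le_natCard_quotient_layerIdeal D n t ht).trans (natCard_quotient_layerIdeal_le_pow D.X hX hnf n)

/-- **ROUTE T's inequality at layer `n` in the kernel: `#t ≤ p^{λ + pⁿ μ}` for every finite family
`t ⊆ A_n[p]`**, `A_n = h_n⁻¹(Sel_{p^∞}(E/K_∞)) ⊆ H¹(K_n, E[p^∞])`, over a number field `K` with
`E(K)[p] = 0`, any `ℤ_p`-extension, any dual datum with `X` torsion and without nonzero finite
submodules (Greenberg Prop. 4.14/4.15 by name downstream). The classes themselves (`p^{t_n}` of them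
from Tamagawa data over `K_n`, X1R0-GAPMAP §14.1) are the remaining input.
[cite: GreenbergLNM1716, §3 pp. 85–86, §5 pp. 114–118, p. 137] -/
theorem card_layerClasses_le_pow [W.IsElliptic] [Module.Finite (IwasawaAlgebra p) D.X]
    (hX : D.IsTorsion) (hnf : ∀ N : Submodule (IwasawaAlgebra p) D.X, Finite N → N = ⊥)
    (hK : ∀ P : W.toAffine.Point, p • P = 0 → P = 0) (n : ℕ)
    (t : Finset {z : W.selmerInftyPreimage κ n // p • z = 0}) :
    t.card ≤ p ^ (lambdaInvariant p D.X + p ^ n * muInvariant p D.X) :=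
  (card_le_natCard_quotient_layerIdeal_of_layerClasses D hK n t).trans
    (natCard_quotient_layerIdeal_le_pow D.X hX hnf n)

end RouteT

end Summit.BirchSwinnertonDyer.Rank1Residual.X1.GeneratorBoundMuLayer

end
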